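import Summits.QuantumFields.YangMills.Theorems.FemtoCurvatureSkewness.Negative.ZeroCoupling
import Summits.QuantumFields.YangMills.Theorems.LatticeGapInUVUnits.Negative.WeakCouplingConcentration
import Literature.Barriers.QuantumFields.ElitzurTheorem

/-!
# `FemtoCurvatureSkewness` — negative-side support II: weak coupling on a fixed torus — `κ₃ → 0`, `Γ₃` must vanish, continuity in `β`

Support file 2/2 for crux `stmt-QuantumFields-9365` (work file §§2b–2c).  The one-point concentration input
(`E_{β,L}[P] → 0`, Laplace principle) is IMPORTED from the `LatticeGapInUVUnits` disprover's landed file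
`Theorems/LatticeGapInUVUnits/Negative/WeakCouplingConcentration.lean` (same route, same two-point package) and read in
the route's variables (`plaq_eq_plaquetteCost`, `tendsto_wE_plaq`); everything else is new.  Tree objects only; no `sorry`.

* `tendsto_kappa3`: the crux's cumulant `κ₃(L, β, n) → 0` as `β → ∞` on every fixed torus (every mixed moment of the
  bounded non-negative plaquette fields is `≤ (2N)^k E_β[P] → 0`);
* `skewnessShape_tendsto_zero`: for EVERY skewness package `Γ₃(n·a(β)) → 0` (box `L = 8n`);
  `not_skewnessPackageWith_of_shape_ge`: no package has `inf Γ₃ > 0`; `not_uniformSkewness`: the natural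
  strengthening "scale-invariant skewness `c₃ ≤ n¹²|κ₃|`" is false for every `G`, `r`, unit map `a`;
* `wE_eq_inv_mul_integral` (`E_β[F] = Z(β)⁻¹ ∫ e^{−βS} F dHaar^{⊗E}`), `continuous_wE`, `continuous_kappa3`: the torus
  Wilson expectation of a continuous observable, hence the crux's cumulant, is continuous in `β` (parametric integral
  over the compact configuration space; `Z⁻¹` is read off `E_β[1] = 1`);
* `exists_zero_of_sign_change` (`'`): a sign change of `β ↦ κ₃(L,β,n)` is an exact zero — with `kappa3_zero_coupling`
  (zero at `β = 0`) and `tendsto_kappa3` (limit `0` at `β = ∞`), the only kill mechanism of the crux is an admissible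
  sign anomaly of a continuous function;
* `twoPointPackage_forces_cov_pos`: the two-point hypothesis is never idle — on every fixed torus `L ≥ 8n` it forces
  `Cov_{β,L}(P_0^{01}, P_{ne₂}^{01}) > 0` for all large `β` (the weak-coupling fact that shields the crux).
-/

noncomputable section

namespace Summit.QuantumFields.YangMills.Theorems.FemtoCurvatureSkewness.Negative

open MeasureTheory Filter Topology
open Literature.MathematicalPhysics.QuantumFieldTheory
open Summit.QuantumFields.YangMills.Theorems.ContinuumLimitOnTrajectory.Negative
open Summit.QuantumFields.YangMills.Theorems.LatticeGapInUVUnits.Negative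
  (neg_card_le_re_trace tendsto_wilsonExpectation_plaquetteCost)

/-! ## §2b Weak-coupling concentration on a fixed torus: `κ₃ → 0`, so `Γ₃` must vanish along the grid

The concentration lemma and the one-point limit are IMPORTED from the `LatticeGapInUVUnits` disprover's landed file
`Theorems/LatticeGapInUVUnits/Negative/WeakCouplingConcentration.lean` (same route, same package); the three-point
consequences are new. -/

section Concentration

variable {G : Type} [Group G] [TopologicalSpace G] [IsTopologicalGroup G] [CompactSpace G]
  [MeasurableSpace G] [BorelSpace G]

omit [IsTopologicalGroup G] [CompactSpace G] [MeasurableSpace G] [BorelSpace G] in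
/-- `0 ≤ P`. -/
theorem plaq_nonneg (r : LatticeRep G) (L : ℕ) (x : Site 4 L) (i j : Fin 4) (U : GaugeConfig 4 L G) :
    0 ≤ plaq r L x i j U :=
  sub_nonneg.2 (Literature.Barriers.QuantumFields.re_trace_le_of_mem_unitaryGroup (r.mem_unitary _))

omit [IsTopologicalGroup G] [CompactSpace G] [MeasurableSpace G] [BorelSpace G] in
/-- `P ≤ 2N`. -/
theorem plaq_le (r : LatticeRep G) (L : ℕ) (x : Site 4 L) (i j : Fin 4) (U : GaugeConfig 4 L G) :
    plaq r L x i j U ≤ 2 * r.N := by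
  have := neg_card_le_re_trace (r.mem_unitary (plaquetteHolonomy U x i j))
  unfold plaq
  linarith

omit [CompactSpace G] [MeasurableSpace G] [BorelSpace G] in
/-- The plaquette field is continuous. -/
theorem continuous_plaq (r : LatticeRep G) (L : ℕ) (x : Site 4 L) (i j : Fin 4) :
    Continuous (plaq r L x i j : GaugeConfig 4 L G → ℝ) := by
  have h1 : Continuous fun U : GaugeConfig 4 L G => plaquetteHolonomy U x i j := by
    unfold plaquetteHolonomy; fun_prop
  exact continuous_const.sub (Complex.continuous_re.comp (r.continuous.comp h1).matrix_trace)

omit [IsTopologicalGroup G] [CompactSpace G] [MeasurableSpace G] [BorelSpace G] in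
/-- The route's `P_x^{ij}` at `i < j` IS the tree's `plaquetteCost` at the plaquette `(x; i, j)`. -/
theorem plaq_eq_plaquetteCost (r : LatticeRep G) (L : ℕ) [NeZero L] (x : Site 4 L) {i j : Fin 4} (hij : i < j)
    (U : GaugeConfig 4 L G) : plaq r L x i j U = plaquetteCost r.ρ U (x, ⟨(i, j), hij⟩) := rfl

/-- **The mean plaquette vanishes at weak coupling on a fixed torus**: `E_{β,L}[P_x^{ij}] → 0` (`i < j`) — the
`LatticeGapInUVUnits` disprover's `tendsto_wilsonExpectation_plaquetteCost` (weak-coupling concentration,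
Laplace principle `μ_{β,L}{S ≥ ε} ≤ e^{−βε/2}/p(ε)`), read in the route's variables. -/
theorem tendsto_wE_plaq (r : LatticeRep G) (L : ℕ) [NeZero L] (x : Site 4 L) {i j : Fin 4} (hij : i < j) :
    Tendsto (fun β => wE r L β (plaq r L x i j)) atTop (𝓝 0) :=
  tendsto_wilsonExpectation_plaquetteCost r L (x, ⟨(i, j), hij⟩)

/-- Squeeze: `E_β[f·g] → 0` whenever `0 ≤ f ≤ M`, `0 ≤ g ≤ M'`, both continuous, and `E_β[g] → 0`. -/
theorem tendsto_wE_mul_of_nonneg (r : LatticeRep G) (L : ℕ) [NeZero L] {f g : GaugeConfig 4 L G → ℝ}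
    (hf : Continuous f) (hg : Continuous g) {M M' : ℝ} (hf0 : ∀ U, 0 ≤ f U) (hfM : ∀ U, f U ≤ M)
    (hg0 : ∀ U, 0 ≤ g U) (hgM : ∀ U, g U ≤ M') (h : Tendsto (fun β => wE r L β g) atTop (𝓝 0)) :
    Tendsto (fun β => wE r L β (fun U => f U * g U)) atTop (𝓝 0) := by
  haveI : SecondCountableTopology G :=
    (r.continuous.isClosedEmbedding r.injective).isEmbedding.secondCountableTopology
  refine tendsto_of_tendsto_of_tendsto_of_le_of_le tendsto_const_nhds (by simpa using h.const_mul M)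
    (fun β => ?_) (fun β => ?_)
  · exact integral_nonneg fun U => mul_nonneg (hf0 U) (hg0 U)
  · haveI := isProbabilityMeasure_wilsonMeasure (d := 4) (L := L) r.ρ r.continuous β
    have hM : 0 ≤ M := (hf0 1).trans (hfM 1)
    have hM' : 0 ≤ M' := (hg0 1).trans (hgM 1)
    have hintR : Integrable (fun U => M * g U) (wilsonMeasure (d := 4) (L := L) r.ρ β) :=
      (Integrable.of_bound hg.aestronglyMeasurable M'
        (Eventually.of_forall fun U => by
          rw [Real.norm_eq_abs, abs_of_nonneg (hg0 U)]; exact hgM U)).const_mul _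
    have hintL : Integrable (fun U => f U * g U) (wilsonMeasure (d := 4) (L := L) r.ρ β) :=
      Integrable.of_bound (hf.mul hg).aestronglyMeasurable (M * M') (Eventually.of_forall fun U => by
        rw [Real.norm_eq_abs, abs_mul, abs_of_nonneg (hf0 U), abs_of_nonneg (hg0 U)]
        exact mul_le_mul (hfM U) (hgM U) (hg0 U) hM)
    calc wE r L β (fun U => f U * g U)
        = ∫ U, f U * g U ∂(wilsonMeasure (d := 4) (L := L) r.ρ β) := rfl
      _ ≤ ∫ U, M * g U ∂(wilsonMeasure (d := 4) (L := L) r.ρ β) :=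
          integral_mono hintL hintR fun U => mul_le_mul_of_nonneg_right (hfM U) (hg0 U)
      _ = M * wE r L β g := integral_const_mul _ _

/-- **The crux's cumulant vanishes at weak coupling on every FIXED torus**: `κ₃(L, β, n) → 0` as `β → ∞`
(every mixed moment of the non-negative, bounded plaquette fields is `≤ (2N)^k E_β[P] → 0`).  The formal shadow of
`n¹² κ₃ = O(g₀⁶) = O(β⁻³)` at fixed lattice separation. -/
theorem tendsto_kappa3 (r : LatticeRep G) (L : ℕ) [NeZero L] (n : ℕ) :
    Tendsto (fun β => kappa3 r L β n) atTop (𝓝 0) := by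
  have h01 : (0 : Fin 4) < 1 := by decide
  have hP : ∀ (x : Site 4 L), Tendsto (fun β => wE r L β (plaq r L x 0 1)) atTop (𝓝 0) :=
    fun x => tendsto_wE_plaq r L x h01
  have hN : (0 : ℝ) ≤ 2 * r.N := by positivity
  have hPP : ∀ (x x' : Site 4 L),
      Tendsto (fun β => wE r L β (fun U => plaq r L x 0 1 U * plaq r L x' 0 1 U)) atTop (𝓝 0) :=
    fun x x' => tendsto_wE_mul_of_nonneg r L (continuous_plaq r L x 0 1) (continuous_plaq r L x' 0 1)
      (plaq_nonneg r L x 0 1) (plaq_le r L x 0 1) (plaq_nonneg r L x' 0 1) (plaq_le r L x' 0 1) (hP x')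
  have hPPP : ∀ (x x' x'' : Site 4 L),
      Tendsto (fun β => wE r L β (fun U => plaq r L x 0 1 U * plaq r L x' 0 1 U * plaq r L x'' 0 1 U))
        atTop (𝓝 0) := by
    intro x x' x''
    refine tendsto_wE_mul_of_nonneg r L ((continuous_plaq r L x 0 1).mul (continuous_plaq r L x' 0 1))
      (continuous_plaq r L x'' 0 1) (M := 2 * r.N * (2 * r.N)) (fun U => ?_) (fun U => ?_)
      (plaq_nonneg r L x'' 0 1) (plaq_le r L x'' 0 1) (hP x'')
    · exact mul_nonneg (plaq_nonneg r L x 0 1 U) (plaq_nonneg r L x' 0 1 U)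
    · exact mul_le_mul (plaq_le r L x 0 1 U) (plaq_le r L x' 0 1 U) (plaq_nonneg r L x' 0 1 U) hN
  set y : Site 4 L := Pi.single (2 : Fin 4) ((n : ℕ) : ZMod L) with hy
  set z : Site 4 L := Pi.single (3 : Fin 4) ((n : ℕ) : ZMod L) with hz
  have key := ((((hPPP 0 y z).sub ((hP 0).mul ((hPP y z).sub ((hP y).mul (hP z))))).sub
    ((hP y).mul ((hPP 0 z).sub ((hP 0).mul (hP z))))).sub
    ((hP z).mul ((hPP 0 y).sub ((hP 0).mul (hP y))))).sub (((hP 0).mul (hP y)).mul (hP z))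
  simp only [mul_zero, sub_zero] at key
  simpa only [kappa3, wCov, hy, hz] using key

/-- Unbundled conclusion with its witnesses named. -/
def SkewnessPackageWith (r : LatticeRep G) (a Γ₃ : ℝ → ℝ) (β₁ ℓ₁ c₃ : ℝ) : Prop :=
  0 < ℓ₁ ∧ 0 < c₃ ∧ (∀ s : ℝ, 0 < s → s ≤ ℓ₁ → 0 < Γ₃ s) ∧
    ∀ (L : ℕ) [NeZero L] (β : ℝ), β₁ ≤ β → (L : ℝ) * a β ≤ ℓ₁ →
      ∀ n : ℕ, 1 ≤ n → 8 * n ≤ L → c₃ * Γ₃ ((n : ℝ) * a β) ≤ (n : ℝ) ^ 12 * |kappa3 r L β n|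

/-- `SkewnessPackage` is `∃ witnesses, SkewnessPackageWith` (definitional). -/
theorem skewnessPackage_iff_exists_with (r : LatticeRep G) (a : ℝ → ℝ) :
    SkewnessPackage r a ↔ ∃ (Γ₃ : ℝ → ℝ) (β₁ ℓ₁ c₃ : ℝ), SkewnessPackageWith r a Γ₃ β₁ ℓ₁ c₃ :=
  Iff.rfl

/-- **TIGHTNESS of `0 < Γ₃`: the skewness shape of ANY package vanishes along the unit map**, on every grid
`s = n·a(β)`: the box `L = 8n` gives `c₃ Γ₃(n a(β)) ≤ n¹² |κ₃(8n, β, n)| → 0`.  The planner's untyped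
"asymptotic-freedom dividend" for the three-point function is FORCED: a prover's `Γ₃` must decay at `0⁺` at least
like the cumulant of the `(8n)⁴` torus; no package has `inf Γ₃ > 0`. -/
theorem skewnessShape_tendsto_zero (r : LatticeRep G) {a Γ₃ : ℝ → ℝ} {β₁ ℓ₁ c₃ : ℝ}
    (h : SkewnessPackageWith r a Γ₃ β₁ ℓ₁ c₃) (ha : ∀ β, 0 < a β) (ha0 : Tendsto a atTop (𝓝 0))
    {n : ℕ} (hn : 1 ≤ n) : Tendsto (fun β => Γ₃ ((n : ℝ) * a β)) atTop (𝓝 0) := by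
  obtain ⟨hℓ₁, hc₃, hΓ₃, hb⟩ := h
  haveI : NeZero (8 * n) := ⟨by omega⟩
  have hLpos : (0 : ℝ) < ((8 * n : ℕ) : ℝ) := by positivity
  have hev : ∀ᶠ β in atTop, a β ∈ Set.Iio (ℓ₁ / ((8 * n : ℕ) : ℝ)) :=
    ha0.eventually_mem (Iio_mem_nhds (div_pos hℓ₁ hLpos))
  have hkey : ∀ᶠ β in atTop, 0 ≤ Γ₃ ((n : ℝ) * a β) ∧
      Γ₃ ((n : ℝ) * a β) ≤ (n : ℝ) ^ 12 * |kappa3 r (8 * n) β n| / c₃ := by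
    filter_upwards [hev, eventually_ge_atTop β₁] with β hβ hβ₁
    have hLa : (((8 * n : ℕ)) : ℝ) * a β ≤ ℓ₁ := by
      have hlt : a β < ℓ₁ / ((8 * n : ℕ) : ℝ) := hβ
      rw [lt_div_iff₀ hLpos] at hlt
      linarith [mul_comm (a β) (((8 * n : ℕ)) : ℝ)]
    obtain ⟨hs, hsℓ⟩ := level_mem_window ha hLa hn le_rfl
    have h1 := hb (8 * n) β hβ₁ hLa n hn le_rfl
    refine ⟨(hΓ₃ _ hs hsℓ).le, ?_⟩
    rw [le_div_iff₀ hc₃]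
    linarith
  refine tendsto_of_tendsto_of_tendsto_of_le_of_le' tendsto_const_nhds ?_
    (hkey.mono fun β h => h.1) (hkey.mono fun β h => h.2)
  have ht := ((tendsto_kappa3 r (8 * n) n).abs.const_mul ((n : ℝ) ^ 12)).div_const c₃
  simpa using ht

/-- Hence **no skewness package has a shape function bounded below** on `(0, ℓ₁]`. -/
theorem not_skewnessPackageWith_of_shape_ge (r : LatticeRep G) {a Γ₃ : ℝ → ℝ} {β₁ ℓ₁ c₃ γ₀ : ℝ}
    (ha : ∀ β, 0 < a β) (ha0 : Tendsto a atTop (𝓝 0)) (hγ : 0 < γ₀)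
    (hΓ : ∀ s : ℝ, 0 < s → s ≤ ℓ₁ → γ₀ ≤ Γ₃ s) : ¬ SkewnessPackageWith r a Γ₃ β₁ ℓ₁ c₃ := by
  intro h
  have ht := skewnessShape_tendsto_zero r h ha ha0 (n := 1) le_rfl
  obtain ⟨hℓ₁, -, -, -⟩ := h
  have hev : ∀ᶠ β in atTop, a β ∈ Set.Iio ℓ₁ := ha0.eventually_mem (Iio_mem_nhds hℓ₁)
  have hlt : ∀ᶠ β in atTop, Γ₃ (((1 : ℕ) : ℝ) * a β) < γ₀ := (tendsto_order.1 ht).2 _ hγ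
  obtain ⟨β, h1, h2⟩ := (hev.and hlt).exists
  have h1' : a β < ℓ₁ := h1
  exact absurd (hΓ (((1 : ℕ) : ℝ) * a β) (by simpa using ha β) (by simpa using h1'.le)) (not_le.2 h2)

/-- NATURAL STRENGTHENING II ("scale-invariant skewness"): the crux's conclusion with `Γ₃ ≡ 1`, i.e. a UNIFORM
positive lower bound `c₃ ≤ n¹²|κ₃|` on all femto tori at weak coupling. -/
def UniformSkewness (r : LatticeRep G) (a : ℝ → ℝ) : Prop :=
  ∃ (β₁ ℓ₁ c₃ : ℝ), 0 < ℓ₁ ∧ 0 < c₃ ∧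
    ∀ (L : ℕ) [NeZero L] (β : ℝ), β₁ ≤ β → (L : ℝ) * a β ≤ ℓ₁ →
      ∀ n : ℕ, 1 ≤ n → 8 * n ≤ L → c₃ ≤ (n : ℝ) ^ 12 * |kappa3 r L β n|

/-- **Scale-invariant skewness is false for every `G`, `r` and every unit map** (`a > 0`, `a → 0`): it is a
skewness package with `Γ₃ ≡ 1`, excluded by `not_skewnessPackageWith_of_shape_ge`.  Any true version of the crux
must let `Γ₃(s) → 0` as `s → 0⁺` (asymptotic freedom of the three-point function, forced by concentration alone). -/
theorem not_uniformSkewness (r : LatticeRep G) {a : ℝ → ℝ} (ha : ∀ β, 0 < a β)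
    (ha0 : Tendsto a atTop (𝓝 0)) : ¬ UniformSkewness r a := by
  rintro ⟨β₁, ℓ₁, c₃, hℓ₁, hc₃, h⟩
  refine not_skewnessPackageWith_of_shape_ge r (Γ₃ := fun _ => 1) (β₁ := β₁) (ℓ₁ := ℓ₁) (c₃ := c₃)
    ha ha0 one_pos (fun _ _ _ => le_rfl) ⟨hℓ₁, hc₃, fun _ _ _ => one_pos, ?_⟩
  intro L _ β hβ hL n hn h8
  simpa using h L β hβ hL n hn h8

end Concentration

/-! ## §2c Continuity in the coupling: sign changes ARE zeros -/

section Continuity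

variable {G : Type} [Group G] [TopologicalSpace G] [IsTopologicalGroup G] [CompactSpace G]
  [MeasurableSpace G] [BorelSpace G]

/-- `E_β[F] = Z(β)⁻¹ ∫ e^{-β S} F dHaar^{⊗E}` (the Wilson state against product Haar). -/
theorem wE_eq_inv_mul_integral (r : LatticeRep G) (L : ℕ) [NeZero L] (β : ℝ) (F : GaugeConfig 4 L G → ℝ) :
    wE r L β F = ((partitionFunction (d := 4) (L := L) r.ρ β)⁻¹).toReal *
      ∫ U, Real.exp (-β * wilsonAction (d := 4) (L := L) r.ρ U) * F U ∂piHaar L := by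
  haveI : SecondCountableTopology G :=
    (r.continuous.isClosedEmbedding r.injective).isEmbedding.secondCountableTopology
  have hdens : Measurable fun U : GaugeConfig 4 L G =>
      ENNReal.ofReal (Real.exp (-β * wilsonAction (d := 4) (L := L) r.ρ U)) :=
    (ENNReal.continuous_ofReal.comp (Real.continuous_exp.comp
      (continuous_const.mul (Literature.Barriers.QuantumFields.Elitzur.continuous_wilsonAction
        (d := 4) (L := L) r.ρ r.continuous)))).measurable
  unfold wE wilsonExpectation wilsonMeasure
  rw [integral_smul_measure]
  unfold wilsonWeight
  rw [integral_withDensity_eq_integral_toReal_smul hdens (ae_of_all _ fun _ => ENNReal.ofReal_lt_top)]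
  simp_rw [ENNReal.toReal_ofReal (Real.exp_nonneg _), smul_eq_mul]

/-- Parametric continuity of `β ↦ ∫ e^{-β S} F dHaar^{⊗E}` for continuous `F` (compact configuration space). -/
theorem continuous_integral_exp_mul (r : LatticeRep G) (L : ℕ) [NeZero L] {F : GaugeConfig 4 L G → ℝ}
    (hF : Continuous F) :
    Continuous fun β : ℝ => ∫ U, Real.exp (-β * wilsonAction (d := 4) (L := L) r.ρ U) * F U ∂piHaar L := by
  haveI : SecondCountableTopology G :=
    (r.continuous.isClosedEmbedding r.injective).isEmbedding.secondCountableTopology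
  have hS : Continuous (wilsonAction (d := 4) (L := L) r.ρ : GaugeConfig 4 L G → ℝ) :=
    Literature.Barriers.QuantumFields.Elitzur.continuous_wilsonAction r.ρ r.continuous
  have hunc : Continuous (Function.uncurry fun (β : ℝ) (U : GaugeConfig 4 L G) =>
      Real.exp (-β * wilsonAction (d := 4) (L := L) r.ρ U) * F U) := by
    show Continuous fun p : ℝ × GaugeConfig 4 L G =>
      Real.exp (-p.1 * wilsonAction (d := 4) (L := L) r.ρ p.2) * F p.2
    exact ((continuous_fst.neg.mul (hS.comp continuous_snd)).rexp).mul (hF.comp continuous_snd)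
  have h := continuous_parametric_integral_of_continuous (μ := piHaar L (G := G)) hunc isCompact_univ
  simpa only [Measure.restrict_univ] using h

/-- **The Wilson expectation of a continuous observable is continuous in the coupling** on a fixed torus. -/
theorem continuous_wE (r : LatticeRep G) (L : ℕ) [NeZero L] {F : GaugeConfig 4 L G → ℝ} (hF : Continuous F) :
    Continuous fun β => wE r L β F := by
  have hN := continuous_integral_exp_mul r L hF
  have hD := continuous_integral_exp_mul r L (F := fun _ => (1 : ℝ)) continuous_const
  have hone : ∀ β : ℝ, wE r L β (fun _ => (1 : ℝ)) = 1 := fun β => by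
    haveI := isProbabilityMeasure_wilsonMeasure (d := 4) (L := L) r.ρ r.continuous β
    simp [wE, wilsonExpectation]
  have hZ : ∀ β : ℝ, ((partitionFunction (d := 4) (L := L) r.ρ β)⁻¹).toReal =
      (∫ U, Real.exp (-β * wilsonAction (d := 4) (L := L) r.ρ U) * (1 : ℝ) ∂piHaar L)⁻¹ := fun β => by
    have h1 := hone β
    rw [wE_eq_inv_mul_integral] at h1
    exact eq_inv_of_mul_eq_one_left h1
  have hD_ne : ∀ β : ℝ, (∫ U, Real.exp (-β * wilsonAction (d := 4) (L := L) r.ρ U) * (1 : ℝ) ∂piHaar L) ≠ 0 :=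
    fun β h0 => by
      have h1 := hone β
      rw [wE_eq_inv_mul_integral, h0, mul_zero] at h1
      exact zero_ne_one h1
  have heq : (fun β => wE r L β F) = fun β =>
      (∫ U, Real.exp (-β * wilsonAction (d := 4) (L := L) r.ρ U) * (1 : ℝ) ∂piHaar L)⁻¹ *
        ∫ U, Real.exp (-β * wilsonAction (d := 4) (L := L) r.ρ U) * F U ∂piHaar L :=
    funext fun β => by rw [wE_eq_inv_mul_integral, hZ β]
  rw [heq]
  exact (hD.inv₀ hD_ne).mul hN

/-- **The crux's cumulant is continuous in `β`** on every fixed torus (finite-dimensional compact integral). -/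
theorem continuous_kappa3 (r : LatticeRep G) (L : ℕ) [NeZero L] (n : ℕ) :
    Continuous fun β => kappa3 r L β n := by
  have hP : ∀ x : Site 4 L, Continuous fun β => wE r L β (plaq r L x 0 1) :=
    fun x => continuous_wE r L (continuous_plaq r L x 0 1)
  have hPP : ∀ x x' : Site 4 L, Continuous fun β => wE r L β (fun U => plaq r L x 0 1 U * plaq r L x' 0 1 U) :=
    fun x x' => continuous_wE r L ((continuous_plaq r L x 0 1).mul (continuous_plaq r L x' 0 1))
  have hPPP : ∀ x x' x'' : Site 4 L, Continuous fun β =>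
      wE r L β (fun U => plaq r L x 0 1 U * plaq r L x' 0 1 U * plaq r L x'' 0 1 U) :=
    fun x x' x'' => continuous_wE r L
      (((continuous_plaq r L x 0 1).mul (continuous_plaq r L x' 0 1)).mul (continuous_plaq r L x'' 0 1))
  set y : Site 4 L := Pi.single (2 : Fin 4) ((n : ℕ) : ZMod L) with hy
  set z : Site 4 L := Pi.single (3 : Fin 4) ((n : ℕ) : ZMod L) with hz
  have key := ((((hPPP 0 y z).sub ((hP 0).mul ((hPP y z).sub ((hP y).mul (hP z))))).sub
    ((hP y).mul ((hPP 0 z).sub ((hP 0).mul (hP z))))).sub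
    ((hP z).mul ((hPP 0 y).sub ((hP 0).mul (hP y))))).sub (((hP 0).mul (hP y)).mul (hP z))
  simpa only [kappa3, wCov, hy, hz, Pi.sub_def, Pi.mul_def] using key

/-- **Sign changes are zeros**: `κ₃(L, b₁, n) ≤ 0 ≤ κ₃(L, b₂, n)` with `b₁ ≤ b₂` yields an exact zero in
`[b₁, b₂]` (no continuity hypothesis left).  With `kappa3_zero_coupling` (`κ₃(L,0,n) = 0`) and `tendsto_kappa3`
(`κ₃ → 0`), the crux's cumulant on each fixed torus is a continuous function vanishing at `β = 0` and at `β = ∞`;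
the crux bets that beyond some `β₁` it never returns to `0` — for EVERY box the adversary's unit map opens. -/
theorem exists_zero_of_sign_change (r : LatticeRep G) (L : ℕ) [NeZero L] (n : ℕ) {b₁ b₂ : ℝ} (hb : b₁ ≤ b₂)
    (h₁ : kappa3 r L b₁ n ≤ 0) (h₂ : 0 ≤ kappa3 r L b₂ n) : ∃ β ∈ Set.Icc b₁ b₂, kappa3 r L β n = 0 :=
  intermediate_value_Icc hb (continuous_kappa3 r L n).continuousOn ⟨h₁, h₂⟩

/-- The symmetric case (`≥ 0` then `≤ 0`). -/
theorem exists_zero_of_sign_change' (r : LatticeRep G) (L : ℕ) [NeZero L] (n : ℕ) {b₁ b₂ : ℝ} (hb : b₁ ≤ b₂)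
    (h₁ : 0 ≤ kappa3 r L b₁ n) (h₂ : kappa3 r L b₂ n ≤ 0) : ∃ β ∈ Set.Icc b₁ b₂, kappa3 r L β n = 0 :=
  intermediate_value_Icc' hb (continuous_kappa3 r L n).continuousOn ⟨h₂, h₁⟩

/-- **The two-point package is never idle**: on every fixed torus `L ≥ 8n` it forces STRICTLY POSITIVE axis
covariances `Cov_{β,L}(P_0^{01}, P_{ne₂}^{01}) > 0` for all large `β` (the admissible couplings of a fixed torus
contain a neighbourhood of `+∞`).  This is the weak-coupling fact the tree cannot supply — the shield of finding 1. -/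
theorem twoPointPackage_forces_cov_pos (r : LatticeRep G) {a : ℝ → ℝ} (h : TwoPointPackage r a) (L : ℕ)
    [NeZero L] (n : ℕ) (hn : 1 ≤ n) (h8 : 8 * n ≤ L) :
    ∀ᶠ β in atTop, 0 < wCov r L β (plaq r L 0 0 1) (plaq r L (Pi.single (2 : Fin 4) ((n : ℕ) : ZMod L)) 0 1) := by
  obtain ⟨Γ, β₀, ℓ₀, c, C, hℓ₀, hc, ha, ha0, hΓ, hbox⟩ := h
  have hLpos : (0 : ℝ) < L := by
    have h8' : (8 : ℝ) * n ≤ L := by exact_mod_cast h8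
    have hn' : (1 : ℝ) ≤ n := by exact_mod_cast hn
    linarith
  have hev : ∀ᶠ β in atTop, a β ∈ Set.Iio (ℓ₀ / L) :=
    ha0.eventually_mem (Iio_mem_nhds (div_pos hℓ₀ hLpos))
  filter_upwards [hev, eventually_ge_atTop β₀] with β hβ hβ₀
  have hLa : (L : ℝ) * a β ≤ ℓ₀ := by
    have hlt : a β < ℓ₀ / L := hβ
    rw [lt_div_iff₀ hLpos] at hlt
    linarith [mul_comm (a β) (L : ℝ)]
  obtain ⟨hax, -⟩ := hbox L β hβ₀ hLa
  obtain ⟨h1, -⟩ := hax n hn h8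
  obtain ⟨hs, hsℓ⟩ := level_mem_window ha hLa hn h8
  have hΓpos := (hΓ _ hs hsℓ).1
  by_contra hle'
  have hle := not_lt.1 hle'
  have hnn : (0 : ℝ) ≤ (n : ℝ) ^ 8 := by positivity
  have := mul_nonpos_iff.2 (Or.inl ⟨hnn, hle⟩)
  linarith [mul_pos hc hΓpos]

end Continuity

end Summit.QuantumFields.YangMills.Theorems.FemtoCurvatureSkewness.Negative
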